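import Mathlib
import Literature.NumberTheory.Sieve.Maynard2016PwClasses
import Literature.NumberTheory.Sieve.BrunTwinPrimes
import HarnessLib

/-!
# Maynard 2016: the size of the base set `{n ≤ U/m : (n(mn − 1), P_w) = 1}`

Topic `Literature/NumberTheory/Sieve`. J. Maynard, *Large gaps between primes*, Ann. of Math. (2)
183 (2016), 915–933 = arXiv:1408.5110, §4 display (4.1) and §6 displays (6.6), (6.17), (6.30):
the sums over `n < U/m`, `(n(mn − 1), P_w) = 1` are evaluated by splitting into residue classes
`n (mod P_w)`; each admissible class contains `U/(m P_w) + O(1)` integers `n ≤ U/m`, and there are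
`∏_{p ≤ w} (p − ω_m(p))` admissible classes (`Maynard2016PwClasses`).

PROVED here (no named facts): the condition `(n(mn − 1), P_w) = 1` is `P_w`-periodic
(`coprime_mul_sub_one_add_Pw_iff`, `periodic_coprime_Pw`), the class density
`∏_{p ≤ w}(p − ω_m(p))/P_w = ∏_{p ≤ w}(1 − ω_m(p)/p)` (`prod_sub_div_Pw_eq`), and the count
`| #baseSet − ⌊U/m⌋ ∏_{p ≤ w}(p − ω_m(p))/P_w | ≤ ∏_{p ≤ w}(p − ω_m(p)) ≤ P_w`
(`abs_card_baseSet_sub_le`, `prod_sub_le_Pw`).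

## References

* J. Maynard, *Large gaps between primes*, Ann. of Math. (2) 183 (2016), 915–933; arXiv:1408.5110,
  §4 (4.1), §6 (6.6), (6.17), (6.30). [Maynard2016LargeGaps]
-/

open Filter Finset
open scoped Topology

namespace Literature.NumberTheory.Sieve

namespace Maynard2016

/-- The condition `(n(mn − 1), P_w) = 1` is `P_w`-periodic in `n` (`m ≥ 1`). [cite: Maynard2016LargeGaps, §6 display (6.6)] -/
theorem coprime_mul_sub_one_add_Pw_iff {m : ℕ} (hm : 1 ≤ m) (x n : ℕ) :
    Nat.Coprime ((n + Pw x) * (m * (n + Pw x) - 1)) (Pw x) ↔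
      Nat.Coprime (n * (m * n - 1)) (Pw x) := by
  have hP : Pw x = ∏ p ∈ (Finset.range (⌊wFun x⌋₊ + 1)).filter Nat.Prime, p := rfl
  have hS : ∀ p ∈ (Finset.range (⌊wFun x⌋₊ + 1)).filter Nat.Prime, p.Prime :=
    fun p hp => (Finset.mem_filter.1 hp).2
  rw [hP, coprime_mul_sub_one_iff_forall hm _ hS, coprime_mul_sub_one_iff_forall hm _ hS]
  refine forall₂_congr fun p hp => ?_
  have hpP : p ∣ ∏ q ∈ (Finset.range (⌊wFun x⌋₊ + 1)).filter Nat.Prime, q :=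
    Finset.dvd_prod_of_mem _ hp
  have h1 : (p ∣ n + ∏ q ∈ (Finset.range (⌊wFun x⌋₊ + 1)).filter Nat.Prime, q) ↔ p ∣ n := by
    rw [add_comm]; exact Nat.dvd_add_right hpP
  have h2 : m * (n + ∏ q ∈ (Finset.range (⌊wFun x⌋₊ + 1)).filter Nat.Prime, q) ≡ m * n [MOD p] := by
    have h0 := Nat.modEq_zero_iff_dvd.2 hpP
    have := ((Nat.ModEq.refl n).add h0).mul_left m
    simpa using this
  exact not_congr (or_congr h1 ⟨fun h => h2.symm.trans h, fun h => h2.trans h⟩)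

/-- `Function.Periodic (fun n ↦ (n(mn − 1), P_w) = 1) P_w`. [cite: Maynard2016LargeGaps, §6 display (6.6)] -/
theorem periodic_coprime_Pw {m : ℕ} (hm : 1 ≤ m) (x : ℕ) :
    Function.Periodic (fun n => Nat.Coprime (n * (m * n - 1)) (Pw x)) (Pw x) :=
  fun n => propext (coprime_mul_sub_one_add_Pw_iff hm x n)

/-- `∏_{p ≤ w} (p − ω_m(p)) ≤ P_w`. [cite: Maynard2016LargeGaps, §6 display (6.6)] -/
theorem prod_sub_le_Pw (m x : ℕ) :
    ∏ p ∈ (Finset.range (⌊wFun x⌋₊ + 1)).filter Nat.Prime,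
        ((p : ℝ) - ((if p ∣ m then 1 else 2 : ℕ) : ℝ)) ≤ (Pw x : ℝ) := by
  have hP : (Pw x : ℝ) = ∏ p ∈ (Finset.range (⌊wFun x⌋₊ + 1)).filter Nat.Prime, (p : ℝ) := by
    show ((primorial ⌊wFun x⌋₊ : ℕ) : ℝ) = _
    unfold primorial
    push_cast
    rfl
  rw [hP]
  refine Finset.prod_le_prod (fun p hp => ?_) (fun p hp => ?_)
  · have hp2 := (Finset.mem_filter.1 hp).2
    split_ifs
    · have : (1 : ℝ) ≤ p := by exact_mod_cast hp2.one_lt.le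
      push_cast; linarith
    · have : (2 : ℝ) ≤ p := by exact_mod_cast hp2.two_le
      push_cast; linarith
  · have : (0 : ℝ) ≤ ((if p ∣ m then 1 else 2 : ℕ) : ℝ) := Nat.cast_nonneg _
    linarith

/-- `0 ≤ ∏_{p ≤ w} (p − ω_m(p))`. [cite: Maynard2016LargeGaps, §6 display (6.6)] -/
theorem prod_sub_nonneg (m x : ℕ) :
    0 ≤ ∏ p ∈ (Finset.range (⌊wFun x⌋₊ + 1)).filter Nat.Prime,
        ((p : ℝ) - ((if p ∣ m then 1 else 2 : ℕ) : ℝ)) := by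
  refine Finset.prod_nonneg fun p hp => ?_
  have hp2 := (Finset.mem_filter.1 hp).2
  split_ifs
  · have : (1 : ℝ) ≤ p := by exact_mod_cast hp2.one_lt.le
    push_cast; linarith
  · have : (2 : ℝ) ≤ p := by exact_mod_cast hp2.two_le
    push_cast; linarith

/-- The class density: `∏_{p ≤ w} (p − ω_m(p)) / P_w = ∏_{p ≤ w} (1 − ω_m(p)/p)` (the indexing
set `{p ≤ ⌊w⌋ prime}` written as `(Iic ⌊w⌋).filter Prime`, as in `singSeriesMQ`).
[cite: Maynard2016LargeGaps, §6 displays (6.17), (6.30)] -/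
theorem prod_sub_div_Pw_eq (m x : ℕ) :
    (∏ p ∈ (Finset.range (⌊wFun x⌋₊ + 1)).filter Nat.Prime,
        ((p : ℝ) - ((if p ∣ m then 1 else 2 : ℕ) : ℝ))) / (Pw x : ℝ) =
      ∏ p ∈ (Finset.Iic ⌊wFun x⌋₊).filter Nat.Prime,
        (1 - ((if p ∣ m then 1 else 2 : ℕ) : ℝ) / p) := by
  have hP : (Pw x : ℝ) = ∏ p ∈ (Finset.range (⌊wFun x⌋₊ + 1)).filter Nat.Prime, (p : ℝ) := by
    show ((primorial ⌊wFun x⌋₊ : ℕ) : ℝ) = _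
    unfold primorial
    push_cast
    rfl
  rw [hP, ← Finset.prod_div_distrib, Nat.range_succ_eq_Iic]
  refine Finset.prod_congr rfl fun p hp => ?_
  have hp0 : (p : ℝ) ≠ 0 := by exact_mod_cast (Finset.mem_filter.1 hp).2.ne_zero
  rw [sub_div, div_self hp0]

/-- **The size of the base set.** For `m ≥ 1`:
`| #{1 ≤ n ≤ ⌊U/m⌋ : (n(mn − 1), P_w) = 1} − ⌊U/m⌋ · ∏_{p ≤ w}(p − ω_m(p)) / P_w |
≤ ∏_{p ≤ w}(p − ω_m(p))`. [cite: Maynard2016LargeGaps, §6 displays (6.6), (6.17)] -/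
theorem abs_card_baseSet_sub_le {m : ℕ} (hm : 1 ≤ m) (C_U ε : ℝ) (x : ℕ) :
    |((baseSet C_U ε x m).card : ℝ) -
        ⌊U C_U ε x / m⌋₊ * (∏ p ∈ (Finset.range (⌊wFun x⌋₊ + 1)).filter Nat.Prime,
          ((p : ℝ) - ((if p ∣ m then 1 else 2 : ℕ) : ℝ))) / (Pw x : ℝ)| ≤
      ∏ p ∈ (Finset.range (⌊wFun x⌋₊ + 1)).filter Nat.Prime,
        ((p : ℝ) - ((if p ∣ m then 1 else 2 : ℕ) : ℝ)) := by
  classical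
  have hPpos : 0 < Pw x := primorial_pos _
  have h := BrunTwinPrimes.abs_card_filter_Icc_sub_le hPpos
    (fun n => Nat.Coprime (n * (m * n - 1)) (Pw x)) (periodic_coprime_Pw hm x) ⌊U C_U ε x / m⌋₊
  have hcount : (Nat.count (fun n => Nat.Coprime (n * (m * n - 1)) (Pw x)) (Pw x) : ℝ) =
      ∏ p ∈ (Finset.range (⌊wFun x⌋₊ + 1)).filter Nat.Prime,
        ((p : ℝ) - ((if p ∣ m then 1 else 2 : ℕ) : ℝ)) := by
    rw [Nat.count_eq_card_filter_range, ← card_filter_range_Pw_coprime hm x]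
  rw [hcount] at h
  have hbs : (baseSet C_U ε x m).card =
      ((Finset.Icc 1 ⌊U C_U ε x / m⌋₊).filter
        (fun n => Nat.Coprime (n * (m * n - 1)) (Pw x))).card := by
    unfold baseSet
    congr 1
  rw [hbs]
  convert h using 2

end Maynard2016

end Literature.NumberTheory.Sieve
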